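import Mathlib
import Literature.MathematicalPhysics.QuantumLattice.WilsonDiracAP
import Summits.QuantumFields.QCD.Theorems.QuarksAsStableActionCriticalLineDiamagnetismStubTadpoleAux

/-!
# The tadpole for `N` colours: finite averaging and the symmetries of the hopping form
(helper for crux stmt-QuantumFields-9307 `FlatCellOptimal`, line `registered`, stub
`stub_hessianMarginAllN`, sub-goal `stub_tadpoleAuxAllN` — the `Fin 3 ↦ Fin N` port of the sibling
crux stmt-QuantumFields-9734's `…CriticalLineDiamagnetismStubTadpoleAux`, gap G2a, wave 3)

What.  The algebra behind the tadpole on the `2⁴` block `(ℤ/2)⁴` with colour `Fin N` (any `N : ℕ`)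
and spin `Fin 4`: the functional `ℓ(E) = Re tr (B⁰⁻¹ Δ(E))` of the matrix-valued link field
`E : Edge 4 2 → M_N(ℂ)` only sees the colour traces `S_μ = Σ_x tr E(x,μ)`.
* Finite averaging (`adInvariant_apply`): an additive functional `g` on `M_N(ℂ)` invariant under
  `A ↦ DAD` (`D = diag(±1)` real) and `A ↦ A.submatrix σ σ` satisfies `g A = g ((tr A / N)·1)`.
  NEW ARGUMENT for general `N` (the sibling used `diag(-1,1,1)` and `finRotate 3` at `N = 3`):
  the sum over ALL `2^N` sign patterns `s : Fin N → Bool` of `D_s A D_s` is `2^N · diag A`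
  (`sign_average`: the entry `(a, b)`, `a ≠ b`, is odd under flipping `s_a`), and the sum over the
  `N` cyclic colour rotations `a ↦ a + j` of `diag v` is `(Σ v)·1` (`cyclic_average`); additivity
  turns both into `2^N g A = 2^N g (diag A)` and `N g (diag A) = N g ((tr A / N)·1)`.  For `N = 0`
  the matrix algebra is a subsingleton and the claim is trivial.
* Assembly (`assembly`): an additive, ℝ-homogeneous functional `f` of link fields invariant under
  block translations, diagonal colour signs and colour permutations satisfies
  `f E = Σ_μ f(tst_μ) · Re S_μ` when all `S_μ` are real, `tst_μ = (1/N)·1` on the link `(0, μ)`.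
* Transport of `tr (B⁻¹ D)` (`tr ((B.submatrix e e)⁻¹ (D.submatrix e e)) = tr (B⁻¹ D)`,
  `tr ((PBP)⁻¹ (PDP)) = tr (B⁻¹ D)` for `P² = 1`) and `(x + t) + μ̂ = (x + μ̂) + t`: these three
  lemmas of the sibling file are already colour-free (`trace_inv_mul_submatrix`,
  `trace_inv_mul_conj`, `shift_add` of namespace
  `Summit.QuantumFields.QCD.Cruxes.CriticalLineDiamagnetism.ChessboardCellGain.Tadpole`); they are
  imported and re-EXPORTED into this namespace (aliases, no restatement), so that `open Tadpole`
  downstream sees the same names as at `N = 3`.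
* The hopping form `H(C⁺, C⁻)` (colour blocks `C⁺_μ(x)` on `x → x + μ̂`, `C⁻_μ(y)` on `y + μ̂ → y`,
  spin factors `1 ∓ γ_μ`, prefactor `−½`; abstracted as a function `H` with its defining equation,
  no `def`s): additive and homogeneous in the blocks, re-indexed by block translations and colour
  permutations, conjugated by diagonal colour matrices (`hop_add`, `hop_smul`,
  `hop_submatrix_translate`, `hop_submatrix_perm`, `hop_diag_conj`) — verbatim the sibling's
  statements with `Fin 3 ↦ Fin N`; all constants are `N`-free.

References: Montvay–Münster, *Quantum Fields on a Lattice* §4.2 (Wilson fermions, hopping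
expansion); folklore linear algebra. Pure theorem file (no `def`s).
-/

noncomputable section

open scoped BigOperators Classical Matrix ComplexConjugate
open Finset
open Literature.MathematicalPhysics.QuantumLattice Literature.MathematicalPhysics.QuantumFieldTheory
  Literature.Probability.LatticeModels

namespace Summit.QuantumFields.QCD.Cruxes.FlatCellOptimal.Tadpole

open Complex (I)

variable {N : ℕ}

/-! ### Finite averaging: Ad-invariant additive functionals on `M_N(ℂ)` -/

/-- Sign averaging over all `2^N` real diagonal sign matrices `D_s`, `(D_s)_{aa} = -1` if `s a` else
`1`, `s : Fin N → Bool`: `Σ_s D_s A D_s = 2^N · diag(A)`. -/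
theorem sign_average (A : Matrix (Fin N) (Fin N) ℂ) :
    ∑ s : Fin N → Bool,
        Matrix.diagonal (fun a => ((if s a then (-1 : ℝ) else 1 : ℝ) : ℂ)) * A *
          Matrix.diagonal (fun a => ((if s a then (-1 : ℝ) else 1 : ℝ) : ℂ)) =
      (2 ^ N : ℕ) • Matrix.diagonal A.diag := by
  ext a b
  simp only [Matrix.sum_apply, Matrix.mul_diagonal, Matrix.diagonal_mul, Matrix.smul_apply]
  by_cases hab : a = b
  · subst hab
    have h1 : ∀ s : Fin N → Bool, ((if s a then (-1 : ℝ) else 1 : ℝ) : ℂ) * A a a *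
        ((if s a then (-1 : ℝ) else 1 : ℝ) : ℂ) = A a a := by
      intro s
      split_ifs <;> push_cast <;> ring
    simp only [h1, Finset.sum_const, Finset.card_univ, Fintype.card_fun, Fintype.card_bool,
      Fintype.card_fin, Matrix.diagonal_apply_eq, Matrix.diag_apply]
  · rw [Matrix.diagonal_apply_ne _ hab, smul_zero]
    -- flipping the `a`-th sign is an involution reversing the sign of every summand
    have hinv : Function.Involutive (fun s : Fin N → Bool => Function.update s a (!s a)) := by
      intro s
      ext c
      by_cases hc : c = a
      · subst hc; simp
      · simp [Function.update_of_ne hc]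
    have key := Equiv.sum_comp (hinv.toPerm _) (fun s : Fin N → Bool =>
      ((if s a then (-1 : ℝ) else 1 : ℝ) : ℂ) * A a b * ((if s b then (-1 : ℝ) else 1 : ℝ) : ℂ))
    have hodd : ∀ s : Fin N → Bool,
        ((if (hinv.toPerm _ s) a then (-1 : ℝ) else 1 : ℝ) : ℂ) * A a b *
            ((if (hinv.toPerm _ s) b then (-1 : ℝ) else 1 : ℝ) : ℂ) =
          -(((if s a then (-1 : ℝ) else 1 : ℝ) : ℂ) * A a b *
            ((if s b then (-1 : ℝ) else 1 : ℝ) : ℂ)) := by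
      intro s
      simp only [Function.Involutive.coe_toPerm, Function.update_self,
        Function.update_of_ne (Ne.symm hab)]
      cases s a <;> simp
    simp only [hodd, Finset.sum_neg_distrib] at key
    linear_combination (-(1 : ℂ) / 2) * key

/-- Cyclic averaging (`N ≥ 1`): the `N` cyclic colour rotations `a ↦ a + j` of `diag(v)` sum to
`(Σ v)·1`. -/
theorem cyclic_average [NeZero N] (v : Fin N → ℂ) :
    ∑ j : Fin N, (Matrix.diagonal v).submatrix (Equiv.addRight j) (Equiv.addRight j) =
      (∑ a, v a) • (1 : Matrix (Fin N) (Fin N) ℂ) := by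
  ext a b
  simp only [Matrix.sum_apply, Matrix.submatrix_apply, Equiv.coe_addRight, Matrix.smul_apply,
    Matrix.one_apply, smul_eq_mul, mul_ite, mul_one, mul_zero]
  by_cases hab : a = b
  · subst hab
    simp only [Matrix.diagonal_apply_eq, if_true]
    exact Equiv.sum_comp (Equiv.addLeft a) v
  · simp [hab]

/-- **Finite averaging.**  An additive functional on `M_N(ℂ)` invariant under conjugation by the
real diagonal sign matrices and under simultaneous row/column permutations only sees `tr A`:
`g A = g ((tr A / N)·1)` (for `N = 0` both sides are `g` of the empty matrix). -/
theorem adInvariant_apply (g : Matrix (Fin N) (Fin N) ℂ → ℝ) (hadd : ∀ A B, g (A + B) = g A + g B)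
    (hdiag : ∀ d : Fin N → ℝ, (∀ a, d a * d a = 1) → ∀ A,
      g (Matrix.diagonal (fun a => (d a : ℂ)) * A * Matrix.diagonal (fun a => (d a : ℂ))) = g A)
    (hperm : ∀ (σ : Equiv.Perm (Fin N)) A, g (A.submatrix σ σ) = g A)
    (A : Matrix (Fin N) (Fin N) ℂ) :
    g A = g ((A.trace / N) • (1 : Matrix (Fin N) (Fin N) ℂ)) := by
  rcases Nat.eq_zero_or_pos N with hN | hN
  · subst hN
    exact congrArg g (Subsingleton.elim _ _)
  haveI : NeZero N := ⟨hN.ne'⟩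
  set G : Matrix (Fin N) (Fin N) ℂ →+ ℝ := AddMonoidHom.mk' g hadd
  have hGg : ∀ B, G B = g B := fun _ => rfl
  -- step 1: the off-diagonal part is invisible
  have hA : g A = g (Matrix.diagonal A.diag) := by
    have key := congrArg G (sign_average A)
    rw [map_sum, map_nsmul] at key
    have hs : ∀ s : Fin N → Bool,
        G (Matrix.diagonal (fun a => ((if s a then (-1 : ℝ) else 1 : ℝ) : ℂ)) * A *
          Matrix.diagonal (fun a => ((if s a then (-1 : ℝ) else 1 : ℝ) : ℂ))) = g A := by
      intro s
      rw [hGg]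
      exact hdiag (fun a => if s a then (-1 : ℝ) else 1) (fun a => by split_ifs <;> norm_num) A
    simp only [hs, Finset.sum_const, Finset.card_univ, Fintype.card_fun, Fintype.card_bool,
      Fintype.card_fin, hGg, nsmul_eq_mul] at key
    exact mul_left_cancel₀ (by positivity) key
  -- step 2: the diagonal part is seen only through its trace
  have hD : (N : ℝ) * g (Matrix.diagonal A.diag) =
      N * g ((A.trace / N) • (1 : Matrix (Fin N) (Fin N) ℂ)) := by
    have key := congrArg G (cyclic_average A.diag)
    rw [map_sum] at key
    have hs : ∀ j : Fin N,
        G ((Matrix.diagonal A.diag).submatrix (Equiv.addRight j) (Equiv.addRight j)) =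
          g (Matrix.diagonal A.diag) := fun j => hperm _ _
    simp only [hs, Finset.sum_const, Finset.card_univ, Fintype.card_fin, nsmul_eq_mul] at key
    have h1 : (∑ a, A.diag a) • (1 : Matrix (Fin N) (Fin N) ℂ) =
        (N : ℕ) • ((A.trace / N) • (1 : Matrix (Fin N) (Fin N) ℂ)) := by
      rw [← Nat.cast_smul_eq_nsmul ℂ, smul_smul,
        mul_div_cancel₀ _ (Nat.cast_ne_zero.2 hN.ne')]
      rfl
    rw [key, h1, map_nsmul, nsmul_eq_mul, hGg]
  rw [hA]
  exact mul_left_cancel₀ (Nat.cast_ne_zero.2 hN.ne') hD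

/-- **Assembly.**  An additive, ℝ-homogeneous functional `f` on link fields `E : Edge 4 2 → M_N(ℂ)`
that is invariant under block translations, diagonal colour signs and colour permutations satisfies
`f E = Σ_μ f(tst_μ) · Re S_μ` whenever all `S_μ = Σ_x tr E(x,μ)` are real. -/
theorem assembly (f : (Edge 4 2 → Matrix (Fin N) (Fin N) ℂ) → ℝ)
    (hadd : ∀ E₁ E₂, f (E₁ + E₂) = f E₁ + f E₂)
    (hsmul : ∀ (r : ℝ) (E : Edge 4 2 → Matrix (Fin N) (Fin N) ℂ), f ((r : ℂ) • E) = r * f E)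
    (htrans : ∀ (t : TorusSite 4 2) (E : Edge 4 2 → Matrix (Fin N) (Fin N) ℂ),
      f (fun e => E (e.1 + t, e.2)) = f E)
    (hdiag : ∀ d : Fin N → ℝ, (∀ a, d a * d a = 1) → ∀ E : Edge 4 2 → Matrix (Fin N) (Fin N) ℂ,
      f (fun e => Matrix.diagonal (fun a => (d a : ℂ)) * E e *
        Matrix.diagonal (fun a => (d a : ℂ))) = f E)
    (hperm : ∀ (σ : Equiv.Perm (Fin N)) (E : Edge 4 2 → Matrix (Fin N) (Fin N) ℂ),
      f (fun e => (E e).submatrix σ σ) = f E)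
    (E : Edge 4 2 → Matrix (Fin N) (Fin N) ℂ) (hE : ∀ μ, (∑ x, (E (x, μ)).trace).im = 0) :
    f E = ∑ μ, f (fun e => if e = ((0 : TorusSite 4 2), μ) then
        (1 / (N : ℂ)) • (1 : Matrix (Fin N) (Fin N) ℂ) else 0) * (∑ x, (E (x, μ)).trace).re := by
  -- the single-link functionals `A ↦ f(δ_{(0,μ)} A)` are additive and Ad-invariant
  have hsadd : ∀ (μ : Fin 4) (A B : Matrix (Fin N) (Fin N) ℂ),
      f (Pi.single ((0 : TorusSite 4 2), μ) (A + B)) =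
        f (Pi.single ((0 : TorusSite 4 2), μ) A) + f (Pi.single ((0 : TorusSite 4 2), μ) B) := by
    intro μ A B
    rw [Pi.single_add, hadd]
  have hsingle : ∀ (μ : Fin 4) (A : Matrix (Fin N) (Fin N) ℂ),
      f (Pi.single ((0 : TorusSite 4 2), μ) A) =
        f (Pi.single ((0 : TorusSite 4 2), μ)
          ((A.trace / N) • (1 : Matrix (Fin N) (Fin N) ℂ))) := by
    intro μ
    refine adInvariant_apply (fun A => f (Pi.single ((0 : TorusSite 4 2), μ) A)) (hsadd μ) ?_ ?_
    · intro d hd A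
      rw [← hdiag d hd (Pi.single _ A)]
      congr 1
      funext e
      by_cases he : e = (0, μ)
      · subst he; simp
      · simp [he]
    · intro σ A
      rw [← hperm σ (Pi.single _ A)]
      congr 1
      funext e
      by_cases he : e = (0, μ)
      · subst he; simp
      · simp [he]
  -- `f` and the single-link functionals as additive monoid homomorphisms
  set F : (Edge 4 2 → Matrix (Fin N) (Fin N) ℂ) →+ ℝ := AddMonoidHom.mk' f hadd with hF
  calc f E = F (∑ e, Pi.single e (E e)) := by rw [Finset.univ_sum_single]; rfl
    _ = ∑ μ, ∑ x, f (Pi.single (x, μ) (E (x, μ))) := by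
      rw [map_sum, Fintype.sum_prod_type, Finset.sum_comm]; rfl
    _ = ∑ μ, ∑ x, f (Pi.single ((0 : TorusSite 4 2), μ) (E (x, μ))) := by
      refine Finset.sum_congr rfl fun μ _ => Finset.sum_congr rfl fun x _ => ?_
      rw [← htrans x (Pi.single (x, μ) (E (x, μ)))]
      congr 1
      funext e
      simp only [Pi.single_apply, Prod.ext_iff, add_eq_right]
    _ = ∑ μ, f (Pi.single ((0 : TorusSite 4 2), μ) (∑ x, E (x, μ))) := by
      refine Finset.sum_congr rfl fun μ _ => ?_
      exact (map_sum (AddMonoidHom.mk' (fun A => f (Pi.single ((0 : TorusSite 4 2), μ) A))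
        (hsadd μ)) (fun x => E (x, μ)) Finset.univ).symm
    _ = ∑ μ, f (fun e => if e = ((0 : TorusSite 4 2), μ) then
          (1 / (N : ℂ)) • (1 : Matrix (Fin N) (Fin N) ℂ) else 0) * (∑ x, (E (x, μ)).trace).re := by
      refine Finset.sum_congr rfl fun μ _ => ?_
      rw [hsingle, Matrix.trace_sum]
      set S : ℂ := ∑ x, (E (x, μ)).trace with hS
      have hSre : S = ((S.re : ℝ) : ℂ) := by
        apply Complex.ext
        · simp
        · simpa [hS] using hE μ
      have h13 : (S / N) • (1 : Matrix (Fin N) (Fin N) ℂ) =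
          ((S.re : ℝ) : ℂ) • ((1 / (N : ℂ)) • (1 : Matrix (Fin N) (Fin N) ℂ)) := by
        rw [smul_smul, hSre, Complex.ofReal_re]; ring_nf
      rw [h13, Pi.single_smul, hsmul, mul_comm]
      congr 2
      funext e
      rw [Pi.single_apply]


/-! ### Colour-free lemmas of the sibling file, re-exported

`trace_inv_mul_submatrix`, `trace_inv_mul_conj` (transport of `tr (B⁻¹ D)` under re-indexing and
involutive conjugation, any index type) and `shift_add` (torus arithmetic) do not mention the colour
index; they are the sibling's declarations, aliased into this namespace. -/

export Summit.QuantumFields.QCD.Cruxes.CriticalLineDiamagnetism.ChessboardCellGain.Tadpole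
  (trace_inv_mul_submatrix trace_inv_mul_conj shift_add)

/-! ### The hopping form and its symmetries

The hopping form `H(C⁺, C⁻)` with colour blocks `C⁺_μ(x)` on the forward hop `x → x + μ̂` and
`C⁻_μ(y)` on the backward hop `y + μ̂ → y` (spin factors `1 ∓ γ_μ`, prefactor `−½`); it is
abstracted as a function `H` satisfying the defining equation `hH` (no `def`s in this file).  The
perturbation is `Δ(E) = H(uE, (uE)ᴴ)` and the free operator is `B⁰ = (m+4)·1 + H(u, ū)`. -/

section Hop

variable {H : (Fin 4 → TorusSite 4 2 → Matrix (Fin N) (Fin N) ℂ) →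
    (Fin 4 → TorusSite 4 2 → Matrix (Fin N) (Fin N) ℂ) →
      Matrix (TorusSite 4 2 × Fin N × Fin 4) (TorusSite 4 2 × Fin N × Fin 4) ℂ}

variable (hH : ∀ Cp Cm, H Cp Cm = Matrix.of fun p q : TorusSite 4 2 × Fin N × Fin 4 =>
    -(1 / 2 : ℂ) * ∑ μ : Fin 4,
      ((if q.1 = Literature.MathematicalPhysics.QuantumFieldTheory.Site.shift p.1 μ then
          ((1 : Matrix (Fin 4) (Fin 4) ℂ) - euclideanGamma μ) p.2.2 q.2.2 * Cp μ p.1 p.2.1 q.2.1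
        else 0) +
        (if p.1 = Literature.MathematicalPhysics.QuantumFieldTheory.Site.shift q.1 μ then
          ((1 : Matrix (Fin 4) (Fin 4) ℂ) + euclideanGamma μ) p.2.2 q.2.2 * Cm μ q.1 p.2.1 q.2.1
        else 0)))
include hH

/-- The hopping form is additive in its blocks. -/
theorem hop_add (Cp Cm Cp' Cm' : Fin 4 → TorusSite 4 2 → Matrix (Fin N) (Fin N) ℂ) :
    H (Cp + Cp') (Cm + Cm') = H Cp Cm + H Cp' Cm' := by
  ext p q
  simp only [hH, Matrix.add_apply, Matrix.of_apply, Pi.add_apply]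
  rw [← mul_add, ← Finset.sum_add_distrib]
  congr 1
  refine Finset.sum_congr rfl fun μ _ => ?_
  split_ifs <;> ring

/-- The hopping form is homogeneous in its blocks. -/
theorem hop_smul (Cp Cm : Fin 4 → TorusSite 4 2 → Matrix (Fin N) (Fin N) ℂ) (c : ℂ) :
    H (c • Cp) (c • Cm) = c • H Cp Cm := by
  ext p q
  simp only [hH, Matrix.smul_apply, Matrix.of_apply, Pi.smul_apply, smul_eq_mul, Finset.mul_sum]
  refine Finset.sum_congr rfl fun μ _ => ?_
  split_ifs <;> ring

/-- **Block translations** re-index the hopping form into the hopping form of the translated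
blocks. -/
theorem hop_submatrix_translate (Cp Cm : Fin 4 → TorusSite 4 2 → Matrix (Fin N) (Fin N) ℂ)
    (t : TorusSite 4 2) :
    (H Cp Cm).submatrix (⇑((Equiv.addRight t).prodCongr (Equiv.refl (Fin N × Fin 4))))
        (⇑((Equiv.addRight t).prodCongr (Equiv.refl (Fin N × Fin 4)))) =
      H (fun μ x => Cp μ (x + t)) (fun μ y => Cm μ (y + t)) := by
  ext p q
  simp only [hH, Matrix.submatrix_apply, Matrix.of_apply, Equiv.prodCongr_apply, Prod.map_fst,
    Prod.map_snd, Equiv.coe_addRight, Equiv.coe_refl, id_eq, shift_add, add_left_inj]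

/-- **Colour permutations** re-index the hopping form into the hopping form of the permuted
blocks. -/
theorem hop_submatrix_perm (Cp Cm : Fin 4 → TorusSite 4 2 → Matrix (Fin N) (Fin N) ℂ)
    (σ : Equiv.Perm (Fin N)) :
    (H Cp Cm).submatrix
        (⇑((Equiv.refl (TorusSite 4 2)).prodCongr (σ.prodCongr (Equiv.refl (Fin 4)))))
        (⇑((Equiv.refl (TorusSite 4 2)).prodCongr (σ.prodCongr (Equiv.refl (Fin 4))))) =
      H (fun μ x => (Cp μ x).submatrix σ σ) (fun μ y => (Cm μ y).submatrix σ σ) := by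
  ext p q
  simp only [hH, Matrix.submatrix_apply, Matrix.of_apply, Equiv.prodCongr_apply, Prod.map_fst,
    Prod.map_snd, Equiv.coe_refl, id_eq]

/-- **Diagonal colour matrices** conjugate the hopping form into the hopping form of the conjugated
blocks. -/
theorem hop_diag_conj (Cp Cm : Fin 4 → TorusSite 4 2 → Matrix (Fin N) (Fin N) ℂ) (d : Fin N → ℂ) :
    Matrix.diagonal (fun p : TorusSite 4 2 × Fin N × Fin 4 => d p.2.1) * H Cp Cm *
        Matrix.diagonal (fun p : TorusSite 4 2 × Fin N × Fin 4 => d p.2.1) =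
      H (fun μ x => Matrix.diagonal d * Cp μ x * Matrix.diagonal d)
        (fun μ y => Matrix.diagonal d * Cm μ y * Matrix.diagonal d) := by
  ext p q
  simp only [hH, Matrix.diagonal_mul, Matrix.mul_diagonal, Matrix.of_apply]
  rw [show ∀ a b c S : ℂ, a * (c * S) * b = c * (a * S * b) from fun a b c S => by ring,
    Finset.mul_sum, Finset.sum_mul]
  congr 1
  refine Finset.sum_congr rfl fun μ _ => ?_
  split_ifs <;> ring

end Hop

/-- **Registered sub-goal of this auxiliary file** (`stub_tadpoleAuxAllN`, the assembly lemma
`Tadpole.assembly` for every colour number `N`): an additive, ℝ-homogeneous functional of link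
fields on the `2⁴` block that is invariant under block translations, real diagonal colour signs and
colour permutations satisfies `f E = Σ_μ f(tst_μ) · Re S_μ` whenever all colour traces
`S_μ = Σ_x tr E(x,μ)` are real, `tst_μ = (1/N)·1` on the link `(0, μ)`. -/
theorem stub_tadpoleAuxAllN : ∀ (N : ℕ) (f : (Edge 4 2 → Matrix (Fin N) (Fin N) ℂ) → ℝ), (∀ E₁ E₂, f (E₁ + E₂) = f E₁ + f E₂) → (∀ (r : ℝ) (E : Edge 4 2 → Matrix (Fin N) (Fin N) ℂ), f ((r : ℂ) • E) = r * f E) → (∀ (t : TorusSite 4 2) (E : Edge 4 2 → Matrix (Fin N) (Fin N) ℂ), f (fun e => E (e.1 + t, e.2)) = f E) → (∀ d : Fin N → ℝ, (∀ a, d a * d a = 1) → ∀ E : Edge 4 2 → Matrix (Fin N) (Fin N) ℂ, f (fun e => Matrix.diagonal (fun a => (d a : ℂ)) * E e * Matrix.diagonal (fun a => (d a : ℂ))) = f E) → (∀ (σ : Equiv.Perm (Fin N)) (E : Edge 4 2 → Matrix (Fin N) (Fin N) ℂ), f (fun e => (E e).submatrix σ σ) = f E) → ∀ E : Edge 4 2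 → Matrix (Fin N) (Fin N) ℂ, (∀ μ : Fin 4, (∑ x : TorusSite 4 2, (E (x, μ)).trace).im = 0) → f E = ∑ μ : Fin 4, f (fun e => if e = ((0 : TorusSite 4 2), μ) then (1 / (N : ℂ)) • (1 : Matrix (Fin N) (Fin N) ℂ) else 0) * (∑ x : TorusSite 4 2, (E (x, μ)).trace).re :=
  fun _ => assembly

end Summit.QuantumFields.QCD.Cruxes.FlatCellOptimal.Tadpole

end
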